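import Mathlib
import HarnessLib
import Summits.ResolutionOfSingularities.Statement
import Literature.AlgebraicGeometry.Resolution.BlowupSequencesExtensions
import Summits.ResolutionOfSingularities.ResolutionOfSingularities.Theorems.ForcedTowerClasses
import Summits.ResolutionOfSingularities.ResolutionOfSingularities.Theorems.DivergentTowerClasses
import Summits.ResolutionOfSingularities.ResolutionOfSingularities.Theorems.MonomialTowerClasses
import Summits.ResolutionOfSingularities.ResolutionOfSingularities.Theorems.HugDimensionClasses
import Summits.ResolutionOfSingularities.ResolutionOfSingularities.Theorems.HugDimensionKernels

/-!
# SurfaceShadow — decomp-res lens-4 («minimal counterexample / extremal reduction») generation 11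

[WRITER NOTE (decomp-res writer g4). This Theorems file is the VOCABULARY (§§2–4: predicates, classes, ports)
of the lens-4 g11 node
`SurfaceShadow` (critic row 70, CRITIC-LEDGER line 91, CLEARED), REBASED on the landed `Theorems.HugDimensionClasses` /
`Theorems.HugDimensionKernels` (node N54): the g10 notions restated in the lens file are now IMPORTED, not restated.
The PROVED kernels (§§1, 3, 5) are `Theorems.SurfaceShadowKernels`; the by-name wiring to the `MaxContactCut` asides (the lens
§6) is `Theorems.MaxContactCutSurfaceShadow`. The paper
proofs below are kept verbatim: they are the blueprint for the prover item `SurfaceLawAll`.]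

BLOCKER FIRST.  Target refined BY NAME: the MaxContactCut aside `NoHuggingTowers` (stmt-31570,
`∀ n ≥ 1, HuggingTowersTerminate n`), and through the tree kernels `noForcedTowers_of_pieces` /
`rungOne_of_pieces` / `core_of_pieces` (Theorems.MaxContactCutMonomialTowers) the items 30253
`NoForcedTowers`, 29273 `RungOne`, 28544 `StepPICoreDimFour`.  Inside 31570, g10 (HugDimension, cleared
critic row 64; landed since as `Theorems.HugDimensionClasses` / `HugDimensionKernels`, imported here)
located the residual `NonMonomialTowersTerminate n` and cut it by the minimal hugged dimension `w`:
`w = 1` DECIDED (curve law), `w = 2` leaf `SurfaceHuggingTowersTerminate`, `w = 3` leaf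
`HypersurfaceHuggingTowersTerminate`, both UNDECIDED.

THE g11 EXTREMAL MOVE (one lens move, on the `w = 2` leaf): minimise the MULTIPLICITY of the hugged
surface germ.  Multiplicity one = a REGULAR surface germ `S = V(u,v) ∋ pt m` hugged for ever.
**SURFACE LAW (new lemma, paper proof below, ALL base fields `k`, all `p`, every ambient dimension):
no infinite forced tower hugs a regular two-dimensional germ.**  Typed as the port `SurfaceLaw n`, whose
conclusion is a CORNER-DESCENT CERTIFICATE `(N ≥ 1, a b : ℕ → ℕ)` with `N ≤ a j + b j` and
`a (j+1) + b (j+1) + 1 ≤ a j + b j`; Lean ends it (`noCornerDescent`, PROVED).  Hence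

* PIECE `RegularSurfaceHuggingTowersTerminate n := NoTower n RegularSurfaceHugging` · DECIDED-MOD-PORT
  (`regularSurface_of_surfaceLaw`), score +1, NEW LEMMA (the port IS the piece logically — said plainly;
  what Lean checks is the descent and every cut below).
* COROLLARY `TwoEternalTowersTerminate n` (two distinct own exceptional components hugged for ever) ·
  DECIDED-MOD-PORT (`TwoEternalSurface` = snc bookkeeping: `E_a ∩ E_b` is a hugged regular surface germ;
  `twoEternal_of_ports`).  With g10's `EternalBound` this leaves AT MOST ONE eternal own component.
* EXACT RE-CUT of g10's surface leaf: `SurfaceHuggingTowersTerminate n ⟺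
  NoTower n (¬EvMon ∧ ¬Curve ∧ Surf ∧ RegS) ∧ SingularSurfaceHuggingTowersTerminate n`
  (`surfaceLeaf_iff`), the first conjunct DECIDED; the LOCATED RESIDUAL of the `w = 2` leaf is
  `SingularSurfaceHuggingTowersTerminate n` — towers hugging (for ever) a surface germ, every hugged
  surface germ SINGULAR at every point, no curve hugged, never monomial.
* EXACT RE-CUT of g10's residual: `NonMonomialTowersTerminate n ⟺ NoTower n (¬EvMon ∧ RegS) ∧
  RoughTowersTerminate n` (`nonMonomial_iff_rough`); `RoughTowersTerminate n := NoTower n (¬EvMon ∧ ¬RegS)`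
  is THE LOCATED RESIDUAL OF THE TOWER SIDE AFTER g11, and `Rough ⟺ (∧ Curve) ∧ SingularSurface ∧
  Hypersurface` (`rough_iff_leaves`).
* BY NAME upward (PROVED, 0 sorry): `noHuggingTowers_of_g11` : g10 ports + `SurfaceLaw` + the two
  residual leaves ⟹ `MaxContactCut.NoHuggingTowers`; then `noForcedTowers_of_g11`, `rungOne_of_g11`,
  `core_of_g11` through the TREE kernels.  Necessity port-free (`leaves_of_noHuggingTowers'`).

WHY STRICTLY WEAKER / NOT A COSTUME.  `RegularSurfaceHuggingTowersTerminate n` is implied by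
`HuggingTowersTerminate n` (mono, no port) and does not imply it: the singular-surface and hypersurface
classes are untouched (bc probes in `g11/bc/Probe.lean`: residual ⇏ target and target ⇏ `SurfaceLaw`
by the cheap batteries; positive controls elaborate).  The port `SurfaceLaw` is NOT a restatement of a
tree item: its hypothesis `RegularSurfaceHugging T` is a new predicate and its conclusion is numerical.

## Paper proof of the SURFACE LAW (port `SurfaceLaw`; d = ambient dimension, n = marking, N := n!)

Setting: forced tower `(Y_i, I_i, pt_i)` (controlled transform with exponent `n`, `ord_{pt_i} I_i = n`... the
typed hypotheses `IsDatum n`, isolation of `pt_i` in `Top(I_i, n)` at every stage), and from stage `m` on a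
hugged REGULAR surface germ: `S_m = V(H) ∋ pt_m`, `𝒪_{Y_m,pt_m}/H_{pt_m}` regular of dimension 2,
`S_{i+1}` = strict transform of `S_i ∋ pt_{i+1}` (this is `HugsGerm`).  Write `R_i = 𝒪_{Y_i,pt_i}`,
`K_i` its residue field, `R̂_i` its completion; `u = (u_1,…,u_{d-2})` regular parameters cutting out `S_i`.
(`d ≤ 3`: one or zero transversal parameters, same text; `d = 2`: `RegularSurfaceHugging` is empty since
`stalkIdeal H = 0` forces `idealOrder H = ⊤`.)

(SL-a) COMPATIBLE COMPLEMENTS.  Choose a Cohen coefficient field and put `Ā_m := K_m[[s,t]] ⊂ R̂_m`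
(`(u,s,t)` an r.s.p.), so `R̂_m = Ā_m[[u]]`.  Inductively, if `R̂_i = Ā_i[[u]]` and `pt_{i+1} ∈ S_{i+1}`
lies in the chart where `s ∈ Ā_i` generates the exceptional ideal (WLOG), let `Ā_{i+1}` be the completion
of the local quadratic transform of `Ā_i` at the point under `pt_{i+1}`; the natural map
`Ā_{i+1}[[U]] → R̂_{i+1}`, `U ↦ u/s`, is an isomorphism (both complete regular local of dimension `d`
with the same residue field `K_{i+1}` and `m_{i+1} = (s, φ, u/s)`; Nakayama).  So `R̂_i = Ā_i[[u_i]]`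
for all `i ≥ m`, `Ā_i ≅ 𝒪̂_{S_i,pt_i}`, and the exceptional curves of the SHADOW (`S_i ∩` exceptional
divisors created after stage `m`, an snc configuration of regular curves on `S_i`) have ALGEBRAIC local
equations in `𝒪_{S_i,pt_i}`; the fourth parameter may be formal — it is never used as a centre.
(SL-b) THE SHADOW.  For `g ∈ I_i R̂_i` write `g = Σ_β g_β u^β` (`g_β ∈ Ā_i`, `β ∈ ℕ^{d-2}`),
`w_β := n − |β|`,
and put `𝒥_i := ( g_β^{N / w_β} : g ∈ I_i R̂_i, |β| < n ) ⊂ Ā_i`, `𝒥̄_i` its integral closure.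
(F1) `ord_{pt_i} I_i = n` ⟹ `ord g_β ≥ w_β` for `|β| < n` ⟹ `ord 𝒥̄_i = ord 𝒥_i ≥ N`; and `𝒥_i ≠ 0`
(else `I_i R̂_i ⊆ (u)^n`, i.e. `S_i ⊆ Top(I_i,n)` by faithful flatness — isolation).
(F2) TRANSFORM LAW: `𝒥̄_{i+1} = closure( s^{-N} · 𝒥̄_i Ā_{i+1} )`.  Proof: `I_{i+1}R̂_{i+1}` is generated by
the `g/s^n = Σ_β (g_β s^{-w_β}) (u/s)^β`, so `s^{-N}𝒥_i Ā_{i+1} ⊆ 𝒥_{i+1}`; conversely a coefficient `f_β`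
(`|β| < n`) of a general member `Σ a_g · g/s^n` is an `Ā_{i+1}`-combination of the `c_δ := g_δ s^{-w_δ}` with
`δ ≤ β`, `w_δ ≥ w_β`, and for every non-negative valuation `v`: `(N/w_β) v(f_β) ≥ (N/w_δ₀) v(c_δ₀) ≥
v(s^{-N}𝒥_i)` — valuative criterion ⟹ `f_β^{N/w_β} ∈ closure(s^{-N}𝒥_iĀ_{i+1})`.  Closures commute with the
monomial factor (`closure(xJ) = x·closure(J)` in the normal domain `Ā_{i+1}`) and `𝒥̄_iĀ_{i+1} ⊆
closure(𝒥_iĀ_{i+1})`.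
(SL-c) THE FINITE-COLENGTH PART DIES.  Zariski: `𝒥̄_i = (h_i) · Q_i` with `Q_i` complete and `m`-primary or
the unit ideal [HunekeSwanson2006 Thm 14.4.6, p.338].  By (F2), `h_{i+1} = s^{c_i} · h_i^{strict}` and
`Q_{i+1} = closure(Q_i^{T} Ā_{i+1})` (`Q_i^T` the transform in the first quadratic transform `T`; it is
`m_T`-primary or the unit ideal since it contains a power of `s` and is prime to `(s)`), and the colength
drops strictly: `λ(Ā_{i+1}/Q_{i+1}) ≤ λ(T/Q_i^T) < λ(Ā_i/Q_i)` while `Q_i ≠ Ā_i` [HunekeSwanson2006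
Lemma 14.3.4 p.333, Prop 14.4.3 p.336 and the Hoskin–Deligne recursion Thm 14.5.4 pp.344–345; a finite
residue field is handled by the faithfully flat base change `Ā_i → Ā_i(X)`, loc. cit. proof of 14.4.9].
Hence `Q_i = Ā_i` for `i ≥ i₁`.
(SL-d) THE NON-EXCEPTIONAL BRANCHES DIE.  For `i ≥ i₁`, `𝒥̄_i = (h_i)`; an analytically irreducible
non-exceptional factor `γ` of `h_i` has strict transform a unit (its branch misses `pt_{i+1}`) or ONE
irreducible factor of `h_{i+1}` (the local ring of the strict transform of the branch is dominated by the
normalisation of the complete domain `Ā_i/(γ)`, a complete DVR, hence is analytically irreducible); no new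
non-exceptional factors appear (`h_{i+1} = s^{c_i} h_i^{strict}`).  So the non-exceptional LINEAGES only
shrink, and an immortal lineage is a formal plane branch followed for ever by the points, regular after
finitely many of these blow-ups (the blown-up rings increase inside the finite normalisation).  From then on
the AMBIENT tower hugs the regular FORMAL ARC `Γ_j = V(γ^{(j)}, u_j) ⊂ Spf R̂_j` — excluded by the
FORMAL CURVE LAW: in coordinates `R̂_j = K[[x_1..x_{d-1}, t]]`, `Γ_j = V(x)` (`K = K_j` constant along an
arc), let `ν := ord_{(x)}(I_jR̂_j)` and `μ_j := min{ord_t f_α : |α| = ν, f ∈ I_jR̂_j}`; by the ARC ORDER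
BOUND below `ν < n`, so `δ := n − ν ≥ 1`; the generators `f/t^n = Σ_α f_α(t) t^{|α|-n} x'^α` of
`I_{j+1}R̂_{j+1} ⊂ K[[x',t]]` force `μ_j ≥ δ` (integrality of the level-`ν` coefficients) and give
`ν_{j+1} = ν`, `μ_{j+1} ≤ μ_j − δ`: infinite descent (`noInfiniteDescent`).  ARC ORDER BOUND: if
`I R̂ ⊆ 𝔓^{(n)}` for a prime `𝔓 ⊂ R̂ = R̂_j` with `dim R̂/𝔓 ≥ 1`, put `𝔓₀ := 𝔓 ∩ R` (`dim R/𝔓₀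
≥ 1`, else
`mR̂ ⊆ 𝔓`); `A := R_{𝔓₀} → B := R̂_𝔓` is flat local with REGULAR closed fibre (R is excellent, EGA IV 7.8.3),
so for `y` lifting an r.s.p. of the fibre, `B' := B/(y)` is flat over `A` with `m_A B' = m_{B'}`
[Matsumura1987 Thm 22.5–22.6, Thm 23.1 (= Matsumura, Commutative Ring Theory, 1986)] and `m_B^n ∩ A
⊆ m_{B'}^n ∩ A = m_A^n B' ∩ A = m_A^n` (faithful
flatness); thus `I ⊆ 𝔓₀^{(n)}`, the positive-dimensional ALGEBRAIC germ `V(𝔓₀) ∋ pt_j` lies in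
`Top(I_j, n)` — contradicting isolation.  Finitely many factors at stage `i₁` ⟹ for `i ≥ i₂` every factor
of `h_i` is exceptional: `𝒥̄_i = (s^a y^b)` or `(s^a)` in the (algebraic) equations of the ≤ 2 shadow
exceptional curves through `pt_i` (`s`: the newest, always present).
(SL-e) ISOLATION TRANSFER: `a, b < N`.  If `a ≥ N` then `g_β^{N/w_β} ∈ (s^a)` gives `v_s(g_β) ≥ a w_β/N ≥ w_β`
for all `g, |β| < n`, so `I_iR̂_i ⊆ (s, u)^n R̂_i = 𝔮^n R̂_i` with `𝔮 = (s̃, u) ⊂ R_i` the ideal of the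
ALGEBRAIC exceptional curve `E ∩ S_i ∋ pt_i` (`s̃` an algebraic equation, `(s̃,u)R̂_i = (s,u)R̂_i`); faithful
flatness ⟹ `I_i ⊆ 𝔮^n` ⟹ `E ∩ S_i ⊆ Top(I_i,n)` — isolation.  Same for `y`.  With (F1): one curve is
impossible (`N ≤ a < N`), so every stage `i ≥ i₂` is a CORNER stage with `a_i, b_i < N ≤ a_i + b_i`.
(SL-f) CORNER DESCENT.  Blow up: if `pt_{i+1}` is the corner of the new curve with the strict transform of
`V(y)` (resp. `V(s)`), then `𝒥̄_{i+1} = (s^{a+b−N} y'^{b})` (resp. `(s'^{a} y^{a+b−N})`): the pair becomes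
`(a+b−N, b)` or `(a, a+b−N)` and the SUM DROPS by `N − a ≥ 1` or `N − b ≥ 1`; if `pt_{i+1}` is any other
point of the new curve then `y/s` is a unit there and `𝒥̄_{i+1} = (s^{a+b−N})` has order `a+b−N < N`,
contradicting (F1).  So `(N, a_{i₂+j}, b_{i₂+j})_j` is a corner-descent certificate: `noCornerDescent`. ∎

Paper proof of `TwoEternalSurface` (COSTUME, snc bookkeeping): if the own components `E_a ≠ E_b` are both
hugged for ever (`Hugs T a ∧ Hugs T b`: `pt_i` on both strict transforms for all large `i`), then from stage
`m = max(a,b)+1` the germ `E_a^{(m)} ∩ E_b^{(m)} ∋ pt_m` is a regular surface germ (snc, `d = 4`; for `d = 3`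
a regular curve — then g10's `CurveLaw` already kills it, and the port may answer with any certificate… we
state the port with conclusion `RegularSurfaceHugging T ∨ CurveHugging T` to stay honest in all `d`), and
for snc divisors through the centre the strict transform of `E_a ∩ E_b` IS `E_a' ∩ E_b'`, so it is hugged.

## The located residual after g11 and its analysis (docstring only; NOT typed as decided)

`RoughTowersTerminate n`: never-monomial towers hugging NO regular surface germ.  By g10's `GeneratorHugging`
and `CurveLaw` such a tower hugs, from every stage, prime divisors of generator size, hugs no curve, and every
hugged surface germ (if any) is SINGULAR at every `pt_i`, for ever (a hugged surface germ whose strict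
transform becomes regular at some `pt_i` is a hugged regular surface germ from there: excluded).  Two leaves:
(A) `SingularSurfaceHuggingTowersTerminate n` · UNDECIDED · ATTACKABLE.  Let `Σ_i ∋ pt_i` be the hugged
singular surface germs (excellent, 2-dimensional, embedded in regular `Y_i`, transformed by the point
blow-ups of the tower).  Hironaka–Bennett: the Hilbert–Samuel function `H_{Σ_i}(pt_i)` is non-increasing for
permissible (point) blow-ups and the set of values is well-founded [CossartJannsenSaito2020 Ch. 2–3], so it
is eventually constant, `= H`, with `e := e(pt_i) ∈ {1, 2}` the directrix dimension eventually constant.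
(α) `e = 1` eventually: the points near `pt_i` on the new exceptional curve are `⊂ ℙ(Dir) =` one point, no
new curve of the `H`-stratum is created inside exceptional curves, the old `H`-curves through the points are
finitely many lineages each EXITED (a regular `H`-curve followed for ever is a hugged regular CURVE: curve
law; a singular one becomes regular); after that the sequence of points IS the fundamental sequence of
[CossartJannsenSaito2020 Def 6.34 / Thm 6.35, p.104–105] at an ISOLATED point of the `H`-stratum (their
hypothesis: no regular `D ⊂ {H_Σ ≥ H}` of dimension `e` through the point; `char k(x) ≥ dim Σ/2 + 1 = 2` or
`= 0` holds, Thm 10.2 p.139), which is FINITE: `H` drops — contradiction with eventual constancy.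
DECIDED-MOD-CITE (port-level; not typed here because `H_Σ` / directrix of the hugged germ are not in the tree).
(β1) `e = 2` eventually and the point `pt_{i+1}` lies on the NEAR LINE `L_i = ℙ(Dir_i) ⊂ E_i ∩ Σ_{i+1}`
(`≅ ℙ¹_{K_i}`, along which `H` is constant) only finitely often: then eventually each point is again
`H`-isolated after the blow-up and [CossartJannsenSaito2020 Thm 6.40, p.106] (fundamental units of length 1)
gives finiteness.  DECIDED-MOD-CITE, same caveat.
(β2) LINE HOPPING: `e = 2` and `pt_{i+1} ∈ L_i` for infinitely many `i`.  CJS then blow up the LINE `L_i`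
(a permissible curve), our towers blow up the point: the CJS termination does not transfer.  THIS IS THE
LOCATED RESIDUAL OF THE `w = 2` LEAF.  INSTRUMENTABLE: census test «T-near-line» (does the next point lie
on the projectivised directrix line of the hugged surface germ, and how often).  IDEA: the ambient datum's
own directrix hyperplane `W_i ⊃ Dir(Σ_i)`?  Unknown; not claimed.
(B) `HypersurfaceHuggingTowersTerminate n` (`w = 3`, only germs of dimension ≥ 3 hugged) · UNDECIDED ·
IDEA-NEEDED, with ONE precise dictionary recorded (not claimed): if a REGULAR hypersurface germ is hugged,
(SL-a)(SL-b)(F1)(F2)(SL-e) go through verbatim with a 3-dimensional complement `Ā_i` and produce a SHADOW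
TOWER `(Ā_i, 𝒥̄_i, N)` — complete 3-dimensional regular local rings under point blow-ups, complete ideals of
order `≥ N` (possibly `> N`: NOT max-order), `Top(𝒥̄_i, N) = {closed point}` EXACTLY (the arc order bound
holds for every prime of `Ā_i` of positive dimension), transform = closure of the `N`-controlled transform,
exceptional exponents `< N` (isolation transfer).  «Regular-hypersurface hugging ⟸ no infinite closure-
normalised forced shadow tower in dimension 3» is a DIMENSION DROP of the forced-tower problem; its own
never-monomial part hugs curves (dead), surface germs (regular: dead by the 2-dimensional shadow = this file;
singular: leaf (A) again) — so modulo bookkeeping the whole tower side would sit on leaf (A)(β2) and on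
SINGULAR-hypersurface-only hugging.  Recorded for g12 / the critic; the closure and the failure of max-order
are exactly why the tree's `SeqDim`/`Cutkosky2009_thm_6_1` (max-order form `∀ y, idealOrder I y ≤ n`) is NOT
invoked anywhere in this file.

DEAD ENDS (g11, one line each): shadow without isolation transfer (golden-ratio corner sequence with
`𝒥 = (st)`, marking 1, persists) — fixed by (SL-e); naive coefficient field `K_i ⊂ K_{i+1}[[…]]` when
`K_{i+1}/K_i` is inseparable (no coefficient field of `R̂_{i+1}` contains `K_i`) — fixed by (SL-a);
multiplicity `e(Q_i)` as the measure (wrong direction for non-complete transforms) — use colength of the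
closure; `SeqDim 2 n` / `Cutkosky2009_thm_6_1` as the surface port — max-order hypothesis fails for shadows
(e.g. `f = u^p + v^p + (s²+t⁵)u^{p−1} + (t²+s⁵)v^{p−1}`); citing CJS for the whole singular-surface leaf —
their units blow up the near line when `e = 2`; intersections of hugged germs need not be hugged
(`V(z)`, `V(z − x²)`) — no canonical minimal hugged germ, hence the extremal choice by (dimension,
multiplicity) and not by inclusion.

NOVELTY (searches RUN, 2026-08-30): `lit search --hybrid "simple complete ideal quadratic transform base
points colength"` → [corpus: book:huneke2006-integral-closure-ideals-rings-modules pp.333–345] (used in SL-c);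
`lit search --hybrid "Hilbert Samuel function fundamental sequence point blowing up surface isolated"` →
[corpus: book:cossart2020-desingularization-invariants-strategy-application-dimension-2 pp.104–107, 139]
(used in (A)); `lean search 'RegularSurfaceHugging|SurfaceLaw|cornerDescent'` → no tree decl; nearest prior
art for the surface law: order reduction of marked ideals on surfaces / basic objects of dimension 2 (any
characteristic) — the delta is the CLOSURE-NORMALISED, NON-MAX-ORDER shadow with isolation transfer along a
forced POINT tower over an arbitrary (imperfect) residue field, typed as a corner-descent certificate.
No hits for "coefficient ideal|shadow ideal|hugged surface" + "forced tower|point tower" in corpus(fts+vec);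
galaxy not queried this generation (sandboxed seat) — said plainly.

BARRIERS.  technique_class: extremal-germ / two-dimensional complete-ideal theory + formal arcs.
`Literature.Barriers.ResolutionOfSingularities.*` (max-contact failure in char p, Moh's jumping, wild
kangaroo points): the surface law never chooses a maximal-contact hypersurface — the hugged regular surface
is a HYPOTHESIS of the class, and the shadow is taken with all coefficients and then integrally closed, so
the characteristic-p pathologies of coefficient ideals on a CHOSEN hypersurface (non-hugging, jumping of the
residual order) do not arise: the residual order is never used, only `Top(𝒥̄,N)`-isolation and colength.
The barriers DO bite on leaf (B) (that is why it is IDEA-NEEDED) and are invisible to leaf (A)(β2), whose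
obstruction is combinatorial-geometric (point towers vs. permissible curve centres).

All theorems below are pure logic over the stated ports; `[folklore]` tags mark kernels whose content is
bookkeeping.  0 `sorry`.
-/

set_option autoImplicit false

open CategoryTheory AlgebraicGeometry
open Literature.AlgebraicGeometry.Resolution
open Summit.ResolutionOfSingularities.ResolutionOfSingularities.Theorems
open WeakOrderReduction ForcedTowerClasses DivergentTowerClasses MonomialTowerClasses HugDimensionClasses HugDimensionKernels

namespace Summit.ResolutionOfSingularities.ResolutionOfSingularities.Theorems.SurfaceShadowClasses

/-! ## §2 Predicates on the tree's `ForcedTower` (g10's = `Theorems.HugDimensionClasses`, imported; `RegularSurfaceHugging`,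
`TwoEternal` new) -/

/-- **NEW (g11): REGULAR SURFACE HUGGING** — a two-dimensional germ `V(H) ∋ pt m` with REGULAR local ring
`𝒪_{St m, pt m} / H_{pt m}` is hugged for ever (multiplicity one: the extremal case of the `w = 2` leaf). -/
def RegularSurfaceHugging (T : ForcedTower) : Prop :=
  ∃ (m : ℕ) (H : (T.St m).IdealSheafData), HugsGerm T m H ∧
    ringKrullDim ((T.St m).presheaf.stalk (T.pt m) ⧸ stalkIdeal H (T.pt m)) = (2 : WithBot ℕ∞) ∧
      IsRegularLocalRing ((T.St m).presheaf.stalk (T.pt m) ⧸ stalkIdeal H (T.pt m))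

/-- **NEW (g11): TWO ETERNAL COMPONENTS** — two distinct own exceptional components are hugged for ever. -/
def TwoEternal (T : ForcedTower) : Prop :=
  ∃ a b : ℕ, a ≠ b ∧ Hugs T a ∧ Hugs T b

/-! ## §3 Tower classes (pieces) and their EXACT calculus -/

/-- **PIECE (g11) · DECIDED-MOD-PORT, NEW LEMMA (`regularSurface_of_surfaceLaw`): no infinite forced tower hugs a
REGULAR SURFACE germ** (all `k`, `p`, `d`). -/
def RegularSurfaceHuggingTowersTerminate (n : ℕ) : Prop := NoTower n RegularSurfaceHugging

/-- **COROLLARY PIECE (g11) · DECIDED-MOD-PORT (`twoEternal_of_ports`): no infinite forced tower hugs TWO of its own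
exceptional components for ever** (so, with g10's `EternalBound`, at most ONE eternal own component). -/
def TwoEternalTowersTerminate (n : ℕ) : Prop := NoTower n TwoEternal

/-- **LEAF (g11) = THE LOCATED RESIDUAL OF THE `w = 2` LEAF · UNDECIDED · ATTACKABLE ((α), (β1) decided-mod-cite in
the docstring; (β2) LINE HOPPING located) · INSTRUMENTABLE («T-near-line»): never-monomial towers hugging a surface
germ, no curve, and NO REGULAR surface germ (every hugged surface germ singular at every point, for ever).** -/
def SingularSurfaceHuggingTowersTerminate (n : ℕ) : Prop :=
  NoTower n fun T => ¬ EventuallyMonomial T ∧ ¬ CurveHugging T ∧ SurfaceHugging T ∧ ¬ RegularSurfaceHugging T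

/-- **THE LOCATED RESIDUAL OF THE TOWER SIDE AFTER g11 (UNDECIDED, score 0): never-monomial towers hugging NO regular
surface germ** (`rough_iff_leaves`: = (∧ curve, dead) ∧ singular-surface leaf ∧ hypersurface leaf). -/
def RoughTowersTerminate (n : ℕ) : Prop := NoTower n fun T => ¬ EventuallyMonomial T ∧ ¬ RegularSurfaceHugging T

/-! ## §4 Ports (HYPOTHESES of kernels, counted 0; paper proofs in the module docstring) -/

/-- **PORT `SurfaceLaw` — NEW LEMMA (paper proof (SL-a)…(SL-f), all `k`, `p`, `d`)**: along a hugged regular surface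
germ the closure-normalised shadow becomes an exceptional corner monomial with exponents `< N = n!` and sum `≥ N`, and
every further step lowers the sum: the port delivers the CORNER-DESCENT CERTIFICATE; Lean ends it (`noCornerDescent`).
Logically this port IS the piece `RegularSurfaceHuggingTowersTerminate n` (said plainly: score «mod port»). -/
def SurfaceLaw (n : ℕ) : Prop :=
  ∀ p : ℕ, p.Prime → ∀ (k : Type) [Field k] [CharP k p] (T : ForcedTower) (g : T.St 0 ⟶ Spec (.of k)),
    IsBase (T.St 0) g → IsDatum n (T.D 0) → (T.D 0).boundary = [] → RegularSurfaceHugging T →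
      ∃ (N : ℕ) (a b : ℕ → ℕ), 1 ≤ N ∧ (∀ j, N ≤ a j + b j) ∧ ∀ j, a (j + 1) + b (j + 1) + 1 ≤ a j + b j

/-- **PORT `TwoEternalSurface` — COSTUME (snc bookkeeping)**: two eternal own components cut out a hugged regular
surface germ (`d = 4`) or a hugged regular curve (`d = 3`). -/
def TwoEternalSurface (n : ℕ) : Prop :=
  ∀ p : ℕ, p.Prime → ∀ (k : Type) [Field k] [CharP k p] (T : ForcedTower) (g : T.St 0 ⟶ Spec (.of k)),
    IsBase (T.St 0) g → IsDatum n (T.D 0) → (T.D 0).boundary = [] → TwoEternal T →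
      RegularSurfaceHugging T ∨ CurveHugging T

/-- **PORT `SurfaceUniformization` — UNDECIDED (= leaf (A) in port shape; (α)/(β1) decided-mod-cite, (β2) open):
a never-monomial tower hugging a surface germ but no curve hugs a REGULAR surface germ.**  Filed so that the residual
leaf has a one-line owner; NOT used in the decided kernels. -/
def SurfaceUniformization (n : ℕ) : Prop :=
  ∀ p : ℕ, p.Prime → ∀ (k : Type) [Field k] [CharP k p] (T : ForcedTower) (g : T.St 0 ⟶ Spec (.of k)),
    IsBase (T.St 0) g → IsDatum n (T.D 0) → (T.D 0).boundary = [] →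
      ¬ EventuallyMonomial T → ¬ CurveHugging T → SurfaceHugging T → RegularSurfaceHugging T

end Summit.ResolutionOfSingularities.ResolutionOfSingularities.Theorems.SurfaceShadowClasses
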